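import Mathlib
import Literature.AlgebraicGeometry.HodgeTheory.WeilClassesCyclicPrym
import Literature.AlgebraicGeometry.VanGeemenVerra2003.QuaternionicHodgeClasses
import HarnessLib

/-!
# WeilClassesCyclicPrymDegreeFourRamifiedFour

Topic `Literature/AlgebraicGeometry/HodgeTheory`. Named literature fact(s) relocated by the gate from `Summits/HodgeConjecture/HodgeConjecture/Theorems/WeilTypeLadderQuaternionicPrymSixfoldsII.lean`
(accept-time relocation of `[cite]`d propositions written inline in a Summits proposal; human ruling 2026-08-15).
Sources: Schoen1988HodgeWeil.

* `Literature.AlgebraicGeometry.HodgeTheory.Schoen1988_cyclicPrym_weilClasses_algebraic_degreeFour_fourBranchPoints`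
-/

namespace Literature.AlgebraicGeometry.HodgeTheory

open CategoryTheory
open Literature.AlgebraicGeometry Literature.AlgebraicGeometry.Motives
open Literature.AlgebraicGeometry.HodgeTheory
open Literature.AlgebraicTopology.SingularHomology
open Literature.AlgebraicGeometry.VanGeemenVerra2003

/-- **Schoen's cyclic theorem, degree `4` over genus `2` with FOUR branch points of types `(1,3,2,2)`: the primitive
Prym SIXFOLD of `ℚ(i)`-Weil type** (Schoen 1988, Thm. 2.0 + Cor. 3.1 at `(q, m, r) = (2, 4, 2)` with a SIMPLE tuple), on
the tree's carriers — the `r = 2` sibling of `Schoen1988_cyclicPrym_weilClasses_algebraic_degreeFour` (`(5, 4, 0)`) and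
`…_twoBranchPoints` (`(3, 4, 1)`), same rendering.
PRINTED STATEMENT: Schoen 1988 (Compositio Math. 65), §2 (p. 11): "Let `C` be an irreducible, smooth, projective curve
… Suppose that an embedding `σ : ℤ/m → Aut(C)` is given. Assume that the invariant `h` associated to `(C, σ)` in §1 is
even. This implies that the number of branch points of the canonical quotient map `π : C → X` is an even number (1.5),
which will be denoted `2r`. … THEOREM 2.0: If the `(ℤ/m)^*` orbit in `(ℤ/m - {0})^{2r}` associated to `(C, σ)` is
simple, then the subspace `U ⊂ H^h(C^h, ℚ(h/2))` is generated by fundamental classes of algebraic cycles"; p. 12: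
p. 11: "A `2r`-tuple in `(ℤ/m - {0})^{2r}` is called simple, if after a permutation of the indices, `a_{2i} = -a_{2i-1}`"; Lemma 1.5 (p. 7): "`h = -e(X°)`"
(`X° ⊂ X` the locus over which `π` is unramified); §3 (p. 24): `B ⊂ Alb(C)` "the abelian subvariety whose tangent space
is the subspace of `T_e Alb(C)` where `ℤ/m` acts by primitive characters … the image of the composition, `P`, of all
elements `Σ_{τ ∈ H}(Id - τ)` [over] the non-zero subgroups `H` of `ℤ/m`", `U' ⊂ ⋀^h H¹(B, ℚ)` Weil's Hodge substructure
of `(B, ℚ(μ_m))` (`h = dim_{ℚ(μ_m)} H¹(B, ℚ)`; "`U' ⊗ ℂ` has pure Hodge type `(h/2, h/2)`"), and "CORROLLARY 3.1: If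
`(C, σ)` satisfies the hypotheses of (2.0), then `U' ⊂ H^h(B, ℚ)` is generated by fundamental classes of codimension
`h/2` algebraic cycles." RENDERING (dictionary steps marked; binder shape of the siblings): `C` is a smooth projective
complex curve with a Jacobian `𝒥` of dimension `10` (= `g(C)`) and an automorphism `α` with `α⁴ = 𝟙` having EXACTLY
TWO fixed complex points, whose square `α²` has EXACTLY SIX fixed complex points — so `σ := α` embeds `ℤ/4` in
`Aut(C)`, the stabilisers are `⟨α⟩` at two points (ramification index `4`, each its own branch point, rotation
exponents `a, a' ∈ {1, 3}`), `{1, α²}` at four further points (two `⟨α⟩`-orbits, two branch points of local monodromy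
`α²`, exponent `2`) and trivial elsewhere: `π : C → X := C/⟨α⟩` has `2r = 4` branch points with tuple `(a, a', 2, 2)`,
`a + a' + 2 + 2 ≡ 0 (mod 4)` (the cover is abelian), i.e. `a' = -a`: the tuple is `(1, 3, 2, 2)` up to order, SIMPLE;
by Riemann–Hurwitz `2·10 - 2 = 4·(2g(X) - 2) + 2·3 + 4·1`, i.e. `g(X) = 2`, so `h = -e(X°) = -((2 - 2·2) - 4) = 6`,
even as §2 requires; `s := α_*` (`Jacobian.pushforward`), a binder `e = s ≫ s`, and `B := (ker (𝟙 + e))⁰ = (ker Φ₄(s))⁰`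
(`AbelianVariety.kerComponent`) = Schoen's `B` for `m = 4` (the image of `(Id - s²)(Id - s)`: the abelian subvariety
with `H₁ = {s² = -1}`; an abelian SIXFOLD, `dim_ℚ H₁(B) = 2h = 12`);
`s_B` the restriction of `s` (`s_B² = -𝟙`), Weil operator `ψ₀ := s_B` (`ℚ(ψ₀) = ℚ(i)`). TYPING (bookkeeping NOT in
print, as the siblings): `weilClassesOf B ψ₀ 3 1 = E₊ ⊔ E₋ = ⋀⁶ H¹_{i} ⊕ ⋀⁶ H¹_{-i} = U' ⊗ ℂ`, and "`U'` is generated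
by … algebraic cycles" is "every class of `weilClassesOf B ψ₀ 3 1` lies in `algebraicClasses B.X 3`". CONSUMER: the
Prym sixfolds of Donagi–Livné's ramified quaternionic towers `(g, a) = (1, 3)` (arXiv:math/0507493 §2), via `⟨i⟩ ⊂ Q`.
-- TODO(general form): Schoen Cor. 3.1 for all `(q, m, r)` with a simple orbit, once the tree has branch data of
-- cyclic covers and `⋀^h_{ℚ(μ_m)}` on real carriers.
[cite: Schoen1988HodgeWeil, Thm 2.0 (p. 11), Lemma 1.5 (p. 7) and Cor 3.1 (p. 24), at (q, m, r) = (2, 4, 2) with the simple tuple (1,3,2,2)]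
[file AlgebraicGeometry/HodgeTheory/WeilClassesCyclicPrymDegreeFourRamifiedFour] -/
def Schoen1988_cyclicPrym_weilClasses_algebraic_degreeFour_fourBranchPoints : Prop :=
  ∀ (C : SchemeOver ℂ) (𝒥 : Jacobian C) (α : C ⟶ C),
    IsSmoothProjective 1 C → 𝒥.J.dim = 10 →
    α ≫ α ≫ α ≫ α = 𝟙 C →
    (∃ R₁ R₂ : ComplexPoints C, R₁ ≠ R₂ ∧ ∀ P : ComplexPoints C, P ≫ α = P ↔ (P = R₁ ∨ P = R₂)) →
    (∃ S : Finset (ComplexPoints C), S.card = 6 ∧ ∀ P : ComplexPoints C, P ≫ (α ≫ α) = P ↔ P ∈ S) →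
  ∀ (s e : 𝒥.J ⟶ 𝒥.J), s = 𝒥.pushforward 𝒥 α → e = s ≫ s →
  ∀ (sB : AbelianVariety.kerComponent (𝟙 𝒥.J + e) ⟶ AbelianVariety.kerComponent (𝟙 𝒥.J + e)),
    sB ≫ AbelianVariety.kerComponentι (𝟙 𝒥.J + e) = AbelianVariety.kerComponentι (𝟙 𝒥.J + e) ≫ s →
  ∀ c ∈ weilClassesOf (AbelianVariety.kerComponent (𝟙 𝒥.J + e)) sB 3 1,
    c ∈ algebraicClasses (AbelianVariety.kerComponent (𝟙 𝒥.J + e)).X 3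

/-! ### The theorems on the quaternionic Prym SIXFOLD `P` -/

end Literature.AlgebraicGeometry.HodgeTheory
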